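import Summits.BirchSwinnertonDyer.Rank1Residual.SmallImageMu.FineMordellWeilCriteria
import Summits.BirchSwinnertonDyer.Rank1Residual.SmallImageMu.ConjARoad
import Summits.BirchSwinnertonDyer.Rank1Residual.SmallImageMu.KatoDivisibility
import HarnessLib
import HarnessLib.Audit

/-!
# Kernel glue of the fine Mordell–Weil criteria: per FMW-certified X9 pair the crux AT THE PAIR (the
# BC5-rung shape); the dichotomy implies the criterion; the criteria reduce DESC-A and the node
# `KatoDivisibilityOnClassX9` to the UNCERTIFIED X9 pairs

HONEST FRAMING (cell `bsd-f3-mu`).  THEOREMS ONLY, sorry-free; CONDITIONAL, credits nothing.  The per-pair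
rung `katoDivisibilityAt_of_fmwCert` is the tribunal/T3 witness shape asked for by the planner of record
(`-imc` g4, TURNKEY-3): an X9 pair carrying the fine Mordell–Weil certificate satisfies Kato's integral
divisibility AT THE PAIR granted the criterion `FineMordellWeilCriterion` (theorem-grade, unproved), S-W⁺
`k ≤ μ(X₀)` at the pair (`hSW`, Kato §17.13, provable), F1, BCS (a) and modularity — T0 is the tree
theorem `Rank1Residual.ConjAAt.fineMuZeroAt` and the finitely-generated-torsion fine datum is discharged
(`Rank1Residual.exists_fineSelmerDualData_finite_isTorsion`).  The class-wide «cover» engines take as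
DATA the disjunction «certified, or (A) holds otherwise» at every X9 pair (`hcover`): the literal shape in
which the criteria REDUCE DESC-A / the node to the uncertified pairs (census: 234 of 415 rank-1 X9 pairs
certified, 38 provably uncertifiable by this road, 143 undecided; rank-0 pairs sit in the known regime).
Ported from `HOME/desc/Sketch4.lean` §3 (sha16 e481a5934f0b7626, rc 0) onto the filed names.

References: [RaySujatha2021] Cor. 2.7; [GreenbergLNM1716] §3, Prop. 3.8; [Kato2004Asterisque] §17.13;
[CoatesSujatha2005] §3; HOME MEMO-desc.md §11.
-/

-- the summit and its single problem are both named `BirchSwinnertonDyer` (registry layout D-0017)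
set_option linter.dupNamespace false

noncomputable section

open scoped Classical MatrixGroups ModularForm

open CongruenceSubgroup WeierstrassCurve Field Literature.NumberTheory.EllipticCurves
  Literature.NumberTheory.EllipticCurves.ModularForms Literature.NumberTheory.IwasawaTheory
  Summit.BirchSwinnertonDyer.BirchSwinnertonDyer.Rank1Residual
open Literature.NumberTheory.EllipticCurves.Rank1Residual (ConjAAt CleanAtP TamagawaCleanAt
  ShaPTorsionFreeAt LocallyIndivisibleAt FineMordellWeilCertAt FineSelmerTrivialAt MuDefectLeFineMuAt
  KatoDivisibilityAt katoDivisibilityAt_of_fineMordellWeilCert conjAAt_of_fineMordellWeilCert)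

namespace Summit.BirchSwinnertonDyer.Rank1Residual.SmallImageMu

/-! ## §1 Pure logic among the three criteria -/

/-- **The dichotomy implies the FMW criterion** (the certificate carries local indivisibility, the
right-hand side of the dichotomy). [cite: RaySujatha2021, Cor. 2.7 and Thm. 2.6 (arXiv:2112.13335 p. 6)] -/
theorem fineMordellWeilCriterion_of_dichotomy (hD : FineMordellWeilDichotomy) :
    FineMordellWeilCriterion := by
  intro W _ p _ hp hirr hcert
  obtain ⟨hP, hT, hSha, hrk, hloc⟩ := hcert
  exact (hD W p hp hirr hP hT hSha hrk).mpr hloc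

/-! ## §2 The BC5-rung shape: an FMW-certified X9 pair satisfies the crux AT THE PAIR -/

section PerPair

variable {W : WeierstrassCurve ℚ} [W.IsElliptic] [W.IsGloballyMinimal] {p : ℕ} [Fact p.Prime]

/-- **An FMW-certified X9 pair satisfies statement (A)** (granted the criterion; X9 pairs have `p ≥ 5`).
[cite: RaySujatha2021, Cor. 2.7] [cite: CoatesSujatha2005, §3 statement (A)] -/
theorem conjAAt_of_fmwCert (hC : FineMordellWeilCriterion) (hX9 : ClassX9 W p)
    (hcert : FineMordellWeilCertAt W p) : ConjAAt W p := by
  obtain ⟨-, hp, -, -, hirr, -⟩ := id hX9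
  exact conjAAt_of_fineMordellWeilCert hC (by omega) hirr hcert

/-- **An FMW-certified X9 pair satisfies the crux `KatoDivisibilityOnClassX9` AT THE PAIR**
(`Rank1Residual.KatoDivisibilityAt W p`), granted the criterion (`hC`), S-W⁺ at the pair (`hSW`), F1
(`hfine`), BCS (a) (`hBCS`) and modularity (`hmodP`) — with NO analytic `μ = 0` certificate, NO class
group, NO `τ` / image input beyond irreducibility (T0 and the torsion fine datum are tree theorems).
Rung instances (census FMW-CERT-v2): 648a1 at `p = 5` (5S4), 9225a1 at `p = 7` (7Ns), 10944cc1 at `p = 5`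
(5Ns), … (234 rank-1 X9 pairs). [cite: Kato2004Asterisque, Thm. 17.4 (p. 273) and §17.13 (pp. 279–280)]
[cite: RaySujatha2021, Cor. 2.7 (arXiv:2112.13335 p. 6)] -/
theorem katoDivisibilityAt_of_fmwCert (hC : FineMordellWeilCriterion)
    (hBCS : burungale_castella_skinner_charIdeal_eq_padicLFunction)
    (hmodP : nonempty_modularParametrizationData)
    (hfine : Kato2004.exists_divisibilityInputs_fineQuotient) (hSW : MuDefectLeFineMuAt W p)
    (hX9 : ClassX9 W p) (hcert : FineMordellWeilCertAt W p) : KatoDivisibilityAt W p := by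
  obtain ⟨-, hp, hgood, hord, hirr, -⟩ := id hX9
  exact katoDivisibilityAt_of_fineMordellWeilCert hC hBCS hmodP hfine hp hgood hord hirr hSW hcert

end PerPair

/-! ## §3 Class-wide reductions: the criteria reduce DESC-A / the node to the uncertified X9 pairs -/

/-- **The FMW criterion reduces DESC-A on X9 to the uncertified pairs**: if every X9 pair is either
FMW-certified or satisfies (A) by some other road (`hcover`, DATA), then `ConjAOnClassX9`.
[cite: CoatesSujatha2005, §3 statement (A)] [cite: RaySujatha2021, Cor. 2.7] -/
theorem conjAOnClassX9_of_fmwCriterion_of_cover (hC : FineMordellWeilCriterion)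
    (hcover : ∀ (W : WeierstrassCurve ℚ) [W.IsElliptic] [W.IsGloballyMinimal] (p : ℕ) [Fact p.Prime],
      ClassX9 W p → FineMordellWeilCertAt W p ∨ ConjAAt W p) :
    ConjAOnClassX9 := by
  intro W _ _ p _ hX9
  rcases hcover W p hX9 with hcert | hA
  · exact conjAAt_of_fmwCert hC hX9 hcert
  · exact hA

/-- **Both criteria (rank one and rank zero) reduce DESC-A on X9 to the pairs certified by neither**:
`hcover` = every X9 pair is FMW-certified (rank one), or clean-at-`p` ∧ Tamagawa-clean ∧ `Ш[p] = 0` ∧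
rank zero, or satisfies (A) otherwise. [cite: RaySujatha2021, Cor. 2.7 (rank ≤ 1)] [cite: GreenbergLNM1716, Prop. 3.8 (p. 95)] -/
theorem conjAOnClassX9_of_criteria_of_cover (hC : FineMordellWeilCriterion)
    (hC0 : RankZeroFineCriterion)
    (hcover : ∀ (W : WeierstrassCurve ℚ) [W.IsElliptic] [W.IsGloballyMinimal] (p : ℕ) [Fact p.Prime],
      ClassX9 W p → FineMordellWeilCertAt W p ∨
        (CleanAtP W p ∧ TamagawaCleanAt W p ∧ ShaPTorsionFreeAt W p ∧ W.mordellWeilRank = 0) ∨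
        ConjAAt W p) :
    ConjAOnClassX9 := by
  intro W _ _ p _ hX9
  obtain ⟨-, hp, -, -, hirr, -⟩ := id hX9
  rcases hcover W p hX9 with hcert | ⟨hP, hT, hSha, hrk⟩ | hA
  · exact conjAAt_of_fmwCert hC hX9 hcert
  · exact (hC0 W p (by omega) hirr hP hT hSha hrk).conjAAt
  · exact hA

/-- **The FMW criterion reduces the node `KatoDivisibilityOnClassX9` to the uncertified pairs** (+ S-W⁺ on
X9, F1, BCS (a), modularity): with `hcover` as above, the crux follows — certified pairs through the
rung, the others through `Rank1Residual.ConjAAt.katoDivisibilityAt`.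
[cite: Kato2004Asterisque, §17.13 (pp. 279–280)] [cite: RaySujatha2021, Cor. 2.7] -/
theorem katoDivisibilityOnClassX9_of_fmwCriterion_of_cover (hC : FineMordellWeilCriterion)
    (hBCS : burungale_castella_skinner_charIdeal_eq_padicLFunction)
    (hmodP : nonempty_modularParametrizationData)
    (hfine : Kato2004.exists_divisibilityInputs_fineQuotient)
    (hSW : ∀ (W : WeierstrassCurve ℚ) [W.IsElliptic] [W.IsGloballyMinimal] (p : ℕ) [Fact p.Prime],
      ClassX9 W p → MuDefectLeFineMuAt W p)
    (hcover : ∀ (W : WeierstrassCurve ℚ) [W.IsElliptic] [W.IsGloballyMinimal] (p : ℕ) [Fact p.Prime],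
      ClassX9 W p → FineMordellWeilCertAt W p ∨ ConjAAt W p) :
    KatoDivisibilityOnClassX9 := by
  intro W _ _ p _ κ γ N _ f hX9 hκ hγ hγ' hf D
  obtain ⟨-, hp, hgood, hord, hirr, -⟩ := id hX9
  have hK : KatoDivisibilityAt W p := by
    rcases hcover W p hX9 with hcert | hA
    · exact katoDivisibilityAt_of_fmwCert hC hBCS hmodP hfine (hSW W p hX9) hX9 hcert
    · exact hA.katoDivisibilityAt hBCS hmodP hfine hp hgood hord hirr (hSW W p hX9)
  exact hK κ γ f hκ hγ hγ' hf D

/-- **With the dichotomy in place of the criterion** (it implies the criterion): the same reduction of the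
node. [cite: RaySujatha2021, Thm. 2.6 and Cor. 2.7] [cite: Kato2004Asterisque, §17.13 (pp. 279–280)] -/
theorem katoDivisibilityOnClassX9_of_dichotomy_of_cover (hD : FineMordellWeilDichotomy)
    (hBCS : burungale_castella_skinner_charIdeal_eq_padicLFunction)
    (hmodP : nonempty_modularParametrizationData)
    (hfine : Kato2004.exists_divisibilityInputs_fineQuotient)
    (hSW : ∀ (W : WeierstrassCurve ℚ) [W.IsElliptic] [W.IsGloballyMinimal] (p : ℕ) [Fact p.Prime],
      ClassX9 W p → MuDefectLeFineMuAt W p)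
    (hcover : ∀ (W : WeierstrassCurve ℚ) [W.IsElliptic] [W.IsGloballyMinimal] (p : ℕ) [Fact p.Prime],
      ClassX9 W p → FineMordellWeilCertAt W p ∨ ConjAAt W p) :
    KatoDivisibilityOnClassX9 :=
  katoDivisibilityOnClassX9_of_fmwCriterion_of_cover (fineMordellWeilCriterion_of_dichotomy hD) hBCS
    hmodP hfine hSW hcover

end Summit.BirchSwinnertonDyer.Rank1Residual.SmallImageMu

end
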